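import Summits.CriticalPhenomena.PercolationContinuityZ3.Theorems.Transplant.FKConnectivityAllQHubCov
import HarnessLib

/-!
# Connectivity correlation inequalities for `φ_{w,q}`, every `q > 0` — the hub covariance bound, file 2:
# NEGATIVE CORRELATION OF ADJACENT EDGES ⟺ THE HUB COVARIANCE BOUND, and consequences

Support file (`--supports stmt-CriticalPhenomena-4575`), FK sub-lane `prim-bschramm-fk-3` (gen 7) of the post-continuity
programme; builds on p205010 (kernel theorem, internal audit signed; external expert review pending).  No definitions, no named
facts, no sorries; standard axioms.  Continues `…AllQHubCov.lean` (statement `HubCovBoundUnder`, node `HubCovBoundFKLtOne`, the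
exact defect identity `negCorr_adj_defect_eq_threePoint`).

PROVED HERE (kernel): `negCorr_adj_iff_hubCovBound` (`0 < q < 1`, `0 < w(xy), w(xz) < 1`): `φ_w(J_xy ∩ J_xz) ≤ φ_w(J_xy)φ_w(J_xz)`
IFF `(1 − q)·Cov_{φ_U}(1{x ↔ y}, 1{x ↔ z}) ≤ φ_U(x ↮ y ↔ z)` for the pinned state `U = w[xy ↦ 0][xz ↦ 0]`; hence
`HubCovBoundFK q → EdgeNegCorrAdjFK q` (`0 < q ≤ 1`), `HubCovBoundFKLtOne → EdgeNegCorrAdjFKLtOne`, and conversely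
`EdgeNegCorrAdjOn V q` gives the bound at every weight vector vanishing on `xy, xz`; the bound on `≤ 4` vertices and on
`K₄`-minor-free supports (`0 < q < 1`, kernel theorems of gen 6 / fk-1 g5), and for EVERY finite weighted graph when `q ≥ 1`
(`hubCovBoundFK_of_one_le`, hub inequality = FKG).  So the node `HubCovBoundFKLtOne` is open exactly for `0 < q < 1` on graphs
with a `K₄` minor and `≥ 5` vertices; evidence bschramm/FK-BARRIER.md §10–§11.
[cite: Grimmett2006, §3.9 eq. (3.94), Conj. (3.96) (pp. 63–66); Thm. (3.8); Thm. (3.1)(a) (p. 37)] [cite: Wagner2006, Conj. 5.3, Thm. 5.8(d), Ex. 5.2 (p. 13)]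
-/

noncomputable section

namespace Summit.CriticalPhenomena.PercolationContinuityZ3.Theorems

namespace FK

open MeasureTheory Set Literature.Probability.LatticeModels Literature.Probability.Percolation
open Literature.Probability.Percolation.DecisionTree (ind ind_of_mem ind_of_not_mem ind_nonneg)
open scoped Classical symmDiff

variable {V : Type*} [Fintype V]

/-! ### Negative correlation of `xy, xz` ⟺ the hub covariance bound for the pinned state -/

/-- **Hub covariance bound ⇒ negative correlation of the adjacent pairs** (`0 < q ≤ 1`, any parameters on `xy, xz`): if the bound
holds for `φ_U`, `U = w[xy ↦ 0][xz ↦ 0]`, at `(x; y, z)` then `φ_w(J_xy ∩ J_xz) ≤ φ_w(J_xy)φ_w(J_xz)` (gen 6's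
`negCorr_adj_of_threePoint`, restated). [cite: Grimmett2006, §3.9 eq. (3.94) (p. 63)] [cite: Wagner2006, Conj. 5.3 (p. 13)] -/
theorem negCorr_adj_of_hubCovBoundUnder {q : ℝ} (hq0 : 0 < q) (hq1 : q ≤ 1) (w : Sym2 V → unitInterval) (x y z : V) (hyz : y ≠ z)
    (h : HubCovBoundUnder (rcMeasureW (Function.update (Function.update w s(x, y) 0) s(x, z) 0) q ∅) q x y z) :
    (rcMeasureW w q ∅).real ({ω | s(x, y) ∈ ω} ∩ {ω | s(x, z) ∈ ω}) ≤
      (rcMeasureW w q ∅).real {ω | s(x, y) ∈ ω} * (rcMeasureW w q ∅).real {ω | s(x, z) ∈ ω} := by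
  rw [hubCovBoundUnder_iff_threePoint hq0] at h
  exact negCorr_adj_of_threePoint hq0 hq1 w x y z hyz (by linarith)

/-- **Negative correlation of the adjacent pairs ⟺ the hub covariance bound** (`0 < q < 1`, `0 < w(xy), w(xz) < 1`, `y ≠ z`):
`φ_w(J_xy ∩ J_xz) ≤ φ_w(J_xy)φ_w(J_xz)` iff `(1 − q)·Cov_{φ_U}(1{x ↔ y}, 1{x ↔ z}) ≤ φ_U(x ↮ y ↔ z)` for `U = w[xy ↦ 0][xz ↦ 0]`.
[cite: Grimmett2006, §3.9 eq. (3.94) (p. 63); Thm. (3.1)(a) (p. 37)] [cite: Wagner2006, Conj. 5.3 (p. 13)] -/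
theorem negCorr_adj_iff_hubCovBound {q : ℝ} (hq0 : 0 < q) (hq1 : q < 1) (w : Sym2 V → unitInterval) (x y z : V) (hyz : y ≠ z)
    (he0 : 0 < (w s(x, y) : ℝ)) (he1 : (w s(x, y) : ℝ) < 1) (hf0 : 0 < (w s(x, z) : ℝ)) (hf1 : (w s(x, z) : ℝ) < 1) :
    (rcMeasureW w q ∅).real ({ω | s(x, y) ∈ ω} ∩ {ω | s(x, z) ∈ ω}) ≤
        (rcMeasureW w q ∅).real {ω | s(x, y) ∈ ω} * (rcMeasureW w q ∅).real {ω | s(x, z) ∈ ω} ↔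
      HubCovBoundUnder (rcMeasureW (Function.update (Function.update w s(x, y) 0) s(x, z) 0) q ∅) q x y z := by
  refine ⟨fun hN => ?_, negCorr_adj_of_hubCovBoundUnder hq0 hq1.le w x y z hyz⟩
  rw [hubCovBoundUnder_iff_threePoint hq0]
  have hZ := rcPartitionFunctionW_pos w hq0 (∅ : Set V)
  rw [rcMeasureW_real_eq_sum_div w hq0 ∅, rcMeasureW_real_eq_sum_div w hq0 ∅, rcMeasureW_real_eq_sum_div w hq0 ∅,
    div_mul_div_comm, div_le_div_iff₀ hZ (mul_pos hZ hZ)] at hN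
  have hdef : (∑ ω : BondConfig V, rcWeightW w q ∅ ω * ind ({ω | s(x, y) ∈ ω} ∩ {ω | s(x, z) ∈ ω}) ω) * rcPartitionFunctionW w q ∅ -
      (∑ ω : BondConfig V, rcWeightW w q ∅ ω * ind {ω | s(x, y) ∈ ω} ω) *
        (∑ ω : BondConfig V, rcWeightW w q ∅ ω * ind {ω | s(x, z) ∈ ω} ω) ≤ 0 := by
    have h' : ((∑ ω : BondConfig V, rcWeightW w q ∅ ω * ind ({ω | s(x, y) ∈ ω} ∩ {ω | s(x, z) ∈ ω}) ω) *
          rcPartitionFunctionW w q ∅ -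
        (∑ ω : BondConfig V, rcWeightW w q ∅ ω * ind {ω | s(x, y) ∈ ω} ω) *
          (∑ ω : BondConfig V, rcWeightW w q ∅ ω * ind {ω | s(x, z) ∈ ω} ω)) * rcPartitionFunctionW w q ∅ ≤
        0 * rcPartitionFunctionW w q ∅ := by nlinarith [hN]
    exact le_of_mul_le_mul_right h' hZ
  rw [negCorr_adj_defect_eq_threePoint w hq0.ne' x y z hyz] at hdef
  have hpre : 0 < (w s(x, y) : ℝ) * (1 - (w s(x, y) : ℝ)) * ((w s(x, z) : ℝ) * (1 - (w s(x, z) : ℝ))) * (q⁻¹ - 1) * q⁻¹ := by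
    have hr : 0 < q⁻¹ - 1 := by rw [sub_pos]; exact (one_lt_inv_iff₀.2 ⟨hq0, hq1⟩)
    have h1 : 0 < (w s(x, y) : ℝ) * (1 - (w s(x, y) : ℝ)) := mul_pos he0 (by linarith)
    have h2 : 0 < (w s(x, z) : ℝ) * (1 - (w s(x, z) : ℝ)) := mul_pos hf0 (by linarith)
    exact mul_pos (mul_pos (mul_pos h1 h2) hr) (inv_pos.2 hq0)
  by_contra hcon
  push Not at hcon
  have := mul_neg_of_pos_of_neg hpre hcon
  linarith

/-! ### Consequences: the two conjecture nodes -/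

omit [Fintype V] in
/-- A non-diagonal pair containing `v` is `s(v, u)` for some `u ≠ v`. [folklore] -/
theorem sym2_eq_mk_of_mem' {e : Sym2 V} {v : V} (hv : v ∈ e) : e = s(v, Sym2.Mem.other hv) :=
  (Sym2.other_spec hv).symm

/-- **`HubCovBound` on `V` ⇒ negative correlation of adjacent edges on `V`** (`0 < q ≤ 1`).
[cite: Grimmett2006, §3.9 eq. (3.94) (p. 63)] [cite: Wagner2006, Conj. 5.3 (p. 13)] -/
theorem edgeNegCorrAdjOn_of_hubCovBound {q : ℝ} (hq0 : 0 < q) (hq1 : q ≤ 1)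
    (h : ∀ (w : Sym2 V → unitInterval) (x y z : V), HubCovBoundUnder (rcMeasureW w q ∅) q x y z) : EdgeNegCorrAdjOn V q := by
  intro w e f he hf hfe hv
  obtain ⟨v, hve, hvf⟩ := hv
  rw [sym2_eq_mk_of_mem' hve, sym2_eq_mk_of_mem' hvf]
  have hyz : Sym2.Mem.other hve ≠ Sym2.Mem.other hvf := by
    intro hh
    apply hfe
    rw [sym2_eq_mk_of_mem' hve, sym2_eq_mk_of_mem' hvf, hh]
  exact negCorr_adj_of_hubCovBoundUnder hq0 hq1 w v _ _ hyz (h _ v _ _)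

/-- **`HubCovBoundFK q → EdgeNegCorrAdjFK q`** (`0 < q ≤ 1`). [cite: Grimmett2006, §3.9 eq. (3.94) (p. 63)] -/
theorem edgeNegCorrAdjFK_of_hubCovBoundFK {q : ℝ} (hq0 : 0 < q) (hq1 : q ≤ 1) (h : HubCovBoundFK q) : EdgeNegCorrAdjFK q :=
  fun n => edgeNegCorrAdjOn_of_hubCovBound hq0 hq1 (h n)

/-- **`HubCovBoundFKLtOne → EdgeNegCorrAdjFKLtOne`**: the hub covariance bound for every `q < 1` gives negative correlation of
adjacent edges for every `q < 1`. [cite: Grimmett2006, §3.9 (p. 63)] [cite: Wagner2006, Conj. 5.3 (p. 13)] -/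
theorem edgeNegCorrAdjFKLtOne_of_hubCovBoundFKLtOne (h : HubCovBoundFKLtOne) : EdgeNegCorrAdjFKLtOne :=
  fun q hq0 hq1 => edgeNegCorrAdjFK_of_hubCovBoundFK hq0 hq1.le (h q hq0 hq1)

/-- **From negative correlation in the state `w[xy ↦ ½][xz ↦ ½]` to the hub covariance bound for `w`** (`0 < q < 1`, `w`
vanishing on `xy, xz`, `y ≠ z`). [cite: Grimmett2006, §3.9 eq. (3.94) (p. 63); Thm. (3.1)(a) (p. 37)] -/
theorem hubCovBoundUnder_of_negCorr_half {q : ℝ} (hq0 : 0 < q) (hq1 : q < 1) (w : Sym2 V → unitInterval) (x y z : V)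
    (hxy : (w s(x, y) : ℝ) = 0) (hxz : (w s(x, z) : ℝ) = 0) (h3 : y ≠ z)
    (hN : (rcMeasureW (Function.update (Function.update w s(x, y) ⟨2⁻¹, by norm_num, by norm_num⟩) s(x, z)
          ⟨2⁻¹, by norm_num, by norm_num⟩) q ∅).real ({ω | s(x, y) ∈ ω} ∩ {ω | s(x, z) ∈ ω}) ≤
        (rcMeasureW (Function.update (Function.update w s(x, y) ⟨2⁻¹, by norm_num, by norm_num⟩) s(x, z)
          ⟨2⁻¹, by norm_num, by norm_num⟩) q ∅).real {ω | s(x, y) ∈ ω} *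
        (rcMeasureW (Function.update (Function.update w s(x, y) ⟨2⁻¹, by norm_num, by norm_num⟩) s(x, z)
          ⟨2⁻¹, by norm_num, by norm_num⟩) q ∅).real {ω | s(x, z) ∈ ω}) :
    HubCovBoundUnder (rcMeasureW w q ∅) q x y z := by
  set half : unitInterval := ⟨2⁻¹, by norm_num, by norm_num⟩ with hhalf
  set u : Sym2 V → unitInterval := Function.update (Function.update w s(x, y) half) s(x, z) half with hu
  have hfe : s(x, z) ≠ s(x, y) := by
    intro h
    rw [Sym2.eq_iff] at h
    rcases h with ⟨-, h⟩ | ⟨h1', h2'⟩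
    · exact h3 h.symm
    · exact h3 (h2'.trans h1').symm
  have hue : (u s(x, y) : ℝ) = 2⁻¹ := by rw [hu, Function.update_of_ne (Ne.symm hfe), Function.update_self]
  have huf : (u s(x, z) : ℝ) = 2⁻¹ := by rw [hu, Function.update_self]
  have hcorner : Function.update (Function.update u s(x, y) 0) s(x, z) 0 = w := by
    rw [hu, Function.update_comm hfe, Function.update_idem, Function.update_idem]
    ext g
    by_cases hg : g = s(x, z)
    · subst hg; rw [Function.update_self]; exact hxz.symm
    · rw [Function.update_of_ne hg]
      by_cases hg' : g = s(x, y)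
      · subst hg'; rw [Function.update_self]; exact hxy.symm
      · rw [Function.update_of_ne hg']
  have key := (negCorr_adj_iff_hubCovBound hq0 hq1 u x y z h3 (by rw [hue]; norm_num) (by rw [hue]; norm_num)
    (by rw [huf]; norm_num) (by rw [huf]; norm_num)).1 hN
  rwa [hcorner] at key

/-- **Negative correlation of adjacent edges ⇒ the hub covariance bound at every pinned state** (`0 < q < 1`): for every weight
vector vanishing on `xy` and `xz`.  (Apply negative correlation in the state `w[xy ↦ ½][xz ↦ ½]`.)
[cite: Grimmett2006, §3.9 eq. (3.94) (p. 63); Thm. (3.1)(a) (p. 37)] -/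
theorem hubCovBoundUnder_of_edgeNegCorrAdjOn {q : ℝ} (hq0 : 0 < q) (hq1 : q < 1) (hNC : EdgeNegCorrAdjOn V q)
    (w : Sym2 V → unitInterval) (x y z : V) (hxy : (w s(x, y) : ℝ) = 0) (hxz : (w s(x, z) : ℝ) = 0) :
    HubCovBoundUnder (rcMeasureW w q ∅) q x y z := by
  haveI := isProbabilityMeasure_rcMeasureW w hq0 (∅ : Set V)
  by_cases h1 : x = y
  · subst h1; exact hubCovBoundUnder_of_eq_left _ q x z
  by_cases h2 : x = z
  · subst h2; exact hubCovBoundUnder_of_eq_right _ q x y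
  by_cases h3 : y = z
  · subst h3; exact hubCovBoundUnder_of_eq _ hq0.le x y
  have hfe : s(x, z) ≠ s(x, y) := by
    intro h
    rw [Sym2.eq_iff] at h
    rcases h with ⟨-, h⟩ | ⟨h1', h2'⟩
    · exact h3 h.symm
    · exact h3 (h2'.trans h1').symm
  refine hubCovBoundUnder_of_negCorr_half hq0 hq1 w x y z hxy hxz h3 ?_
  exact hNC _ s(x, y) s(x, z) (by rw [Sym2.mk_isDiag_iff]; exact h1) (by rw [Sym2.mk_isDiag_iff]; exact h2) hfe
    ⟨x, Sym2.mem_mk_left _ _, Sym2.mem_mk_left _ _⟩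

/-- **The hub covariance bound on every vertex type with at most four elements** (`0 < q < 1`, weight vectors vanishing on `xy, xz`):
from negative association on `≤ 4` vertices (`K₄` is Potts–Rayleigh, gen 6). [cite: Wagner2006, Ex. 5.2, §5.3] -/
theorem hubCovBoundUnder_of_card_le_four (hV : Fintype.card V ≤ 4) {q : ℝ} (hq0 : 0 < q) (hq1 : q < 1)
    (w : Sym2 V → unitInterval) (x y z : V) (hxy : (w s(x, y) : ℝ) = 0) (hxz : (w s(x, z) : ℝ) = 0) :
    HubCovBoundUnder (rcMeasureW w q ∅) q x y z :=
  hubCovBoundUnder_of_edgeNegCorrAdjOn hq0 hq1 (edgeNegCorrAdjOn_of_card_le_four hV hq0 hq1.le) w x y z hxy hxz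

/-- **The hub covariance bound when `supp w ∪ {xy, xz}` has no `K₄` minor** (`0 < q < 1`, `w` vanishing on `xy, xz`, `x, y, z`
distinct): from the discharged Wagner theorem (negative association on series–parallel graphs). [cite: Wagner2006, Thm. 5.8(d), §5.3] -/
theorem hubCovBoundUnder_of_noK4Minor {n : ℕ} {q : ℝ} (hq0 : 0 < q) (hq1 : q < 1) (w : Sym2 (Fin n) → unitInterval)
    (x y z : Fin n) (hxy : (w s(x, y) : ℝ) = 0) (hxz : (w s(x, z) : ℝ) = 0) (h1 : x ≠ y) (h3 : y ≠ z)
    (hK : ¬ HasK4Minor (SimpleGraph.fromEdgeSet ({e : Sym2 (Fin n) | ((w e : unitInterval) : ℝ) ≠ 0} ∪ {s(x, y), s(x, z)}))) :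
    HubCovBoundUnder (rcMeasureW w q ∅) q x y z := by
  have hfe : s(x, z) ≠ s(x, y) := by
    intro h
    rw [Sym2.eq_iff] at h
    rcases h with ⟨-, h⟩ | ⟨h1', h2'⟩
    · exact h3 h.symm
    · exact h3 (h2'.trans h1').symm
  refine hubCovBoundUnder_of_negCorr_half hq0 hq1 w x y z hxy hxz h3 ?_
  refine edgeNegCorrAdj_of_noK4Minor _ hq0 hq1.le ?_ s(x, y) s(x, z) (by rw [Sym2.mk_isDiag_iff]; exact h1) hfe
  convert hK using 3
  ext g
  simp only [Set.mem_setOf_eq, Set.mem_union, Set.mem_insert_iff, Set.mem_singleton_iff, Function.update_apply]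
  by_cases hg : g = s(x, z)
  · simp only [hg, if_true, or_true, iff_true]; norm_num
  · by_cases hg' : g = s(x, y)
    · simp only [hg', if_true, true_or, or_true, iff_true]
      rw [if_neg (Ne.symm hfe)]; norm_num
    · simp only [hg, hg', if_false, or_false]

/-! ### The bound for `q ≥ 1` (hub inequality = FKG) -/

/-- **The hub covariance bound holds for every `q ≥ 1`** on every finite weighted graph: there `1 − q ≤ 0` while the hub covariance
is `≥ 0` (positive association). [cite: Grimmett2006, Thm. (3.8) (p. 39); §3.9 (p. 63)] -/
theorem hubCovBoundFK_of_one_le {q : ℝ} (hq : 1 ≤ q) : HubCovBoundFK q := by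
  intro n w x y z
  have hq0 : 0 < q := by linarith
  haveI := isProbabilityMeasure_rcMeasureW w hq0 (∅ : Set (Fin n))
  have hH := hubFK_of_pairConnPosFK (pairConnPosFK_of_one_le hq) n w y x z
  unfold HubUnder at hH
  unfold HubCovBoundUnder
  rw [openConn_comm y x, openConn_comm z x] at hH
  have hcov : 0 ≤ (rcMeasureW w q ∅).real (openConn x y ∩ openConn x z) * (rcMeasureW w q ∅).real univ -
      (rcMeasureW w q ∅).real (openConn x y) * (rcMeasureW w q ∅).real (openConn x z) := by linarith
  have h1 : (1 - q) * ((rcMeasureW w q ∅).real (openConn x y ∩ openConn x z) * (rcMeasureW w q ∅).real univ -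
      (rcMeasureW w q ∅).real (openConn x y) * (rcMeasureW w q ∅).real (openConn x z)) ≤ 0 :=
    mul_nonpos_of_nonpos_of_nonneg (by linarith) hcov
  exact h1.trans (mul_nonneg measureReal_nonneg measureReal_nonneg)

end FK

end Summit.CriticalPhenomena.PercolationContinuityZ3.Theorems

end
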